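import Summits.Ventures.PercRepro.C025ProfilePLDClosureArith

/-!
# THE LINE U_{2,m} FOR EVERY m ≥ m₀ FROM THE CASE m = m₀: THE ARITHMETIC (night-3 g31)

`proofs/NIGHT3-G31-TWOLIFT.md`.  The profile of `U_{2,m}` (the family of pairs `(min |J| 2, min (m−|J|) 2)`, `J ⊆ [m]`)
is `T₀₂ + m·T₁₂ + c_m·δ₂₂`, `c_m = Σ_{2 ≤ i ≤ m−2} C(m,i)` (`sum_choose_min_two`, `m ≥ 3`); `m ↦ c_m` is non-decreasing
(`sum_choose_mid_mono`).  For a family `(s, x, f)` with PER-LAYER DOMINANCE, the pairs `(x+1, f+2), (x+2, f+1)` (`T₁₂` =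
`PLDClosure.coloop` after `PLDClosure.shift11`) and `(x+2, f+2)` (`shift11` twice) satisfy every (PLD) instance (g29), so
every (PLD) instance of the family convolved with `U_{2,m}` is the same instance for `U_{2,m₀}` plus `(m − m₀)` times a
`T₁₂`-instance plus `(c_m − c_{m₀})` times a `δ₂₂`-instance (`lift_instance`, `3 ≤ m₀ ≤ m`): a certificate for ONE `m₀`
certifies every `m ≥ m₀`.  No `def`, no `instance`, no notation.  Axioms: standard.
-/

namespace PercRepro

open Finset

namespace PLDTwoLiftGen

variable {ι : Type}

/-- The uniform profile of `U_{2,m}`, `m ≥ 3`: `Σ_{i ≤ m} C(m,i)·g(min i 2, min (m−i) 2)` is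
`g 0 2 + m·g 1 2 + c_m·g 2 2 + m·g 2 1 + g 2 0` with `c_m = Σ_{2 ≤ i ≤ m−2} C(m,i)` (`c_3 = 0`). -/
theorem sum_choose_min_two (m : ℕ) (hm : 3 ≤ m) (g : ℕ → ℕ → ℕ) :
    ∑ i ∈ range (m + 1), m.choose i * g (min i 2) (min (m - i) 2) =
      g 0 2 + m * g 1 2 + (∑ i ∈ Ico 2 (m - 1), m.choose i) * g 2 2 + m * g 2 1 + g 2 0 := by
  obtain ⟨k, rfl⟩ : ∃ k, m = k + 3 := ⟨m - 3, by omega⟩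
  rw [sum_range_succ, sum_range_succ, sum_range_succ', sum_range_succ']
  have hmid : ∀ i ∈ range k, (k + 3).choose (i + 1 + 1) * g (min (i + 1 + 1) 2) (min (k + 3 - (i + 1 + 1)) 2) =
      (k + 3).choose (i + 1 + 1) * g 2 2 := by
    intro i hi
    rw [mem_range] at hi
    rw [show min (i + 1 + 1) 2 = 2 by omega, show min (k + 3 - (i + 1 + 1)) 2 = 2 by omega]
  rw [sum_congr rfl hmid, ← sum_mul, show k + 3 - 1 = k + 2 by omega, sum_Ico_eq_sum_range,
    show k + 2 - 2 = k by omega]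
  have hc : ∑ i ∈ range k, (k + 3).choose (2 + i) = ∑ i ∈ range k, (k + 3).choose (i + 1 + 1) :=
    sum_congr rfl fun i _ => by rw [show 2 + i = i + 1 + 1 by omega]
  have h1 : (k + 3).choose (0 + 1) = k + 3 := Nat.choose_one_right _
  have h2 : (k + 3).choose (k + 2) = k + 3 := Nat.choose_succ_self_right (k + 2)
  rw [hc, Nat.choose_zero_right, Nat.choose_self, h1, h2]
  simp only [show min (0 + 1) 2 = 1 by omega, show min (k + 2) 2 = 2 by omega, show min 0 2 = 0 by omega,
    show k + 3 - 0 = k + 3 by omega, show min (k + 3) 2 = 2 by omega, show k + 3 - (k + 2) = 1 by omega,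
    show k + 3 - (k + 3) = 0 by omega, one_mul]
  ring

/-- `c_{m₀} ≤ c_m` for `m₀ ≤ m`: the index set grows and `C(m₀, i) ≤ C(m, i)`. -/
theorem sum_choose_mid_mono (m₀ m : ℕ) (hm : m₀ ≤ m) :
    ∑ i ∈ Ico 2 (m₀ - 1), m₀.choose i ≤ ∑ i ∈ Ico 2 (m - 1), m.choose i := by
  calc ∑ i ∈ Ico 2 (m₀ - 1), m₀.choose i ≤ ∑ i ∈ Ico 2 (m₀ - 1), m.choose i :=
        sum_le_sum fun i _ => Nat.choose_le_choose i hm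
    _ ≤ ∑ i ∈ Ico 2 (m - 1), m.choose i :=
        sum_le_sum_of_subset_of_nonneg (Ico_subset_Ico le_rfl (by omega)) fun _ _ _ => Nat.zero_le _

/-- THE LIFT IN `m`: for a family `(s, x, f)` with (PLD) and `3 ≤ m₀ ≤ m`, the (PLD) instance `(lo, hi, δ, Θ)` of the
family convolved with `U_{2,m}` follows from the same instance of the family convolved with `U_{2,m₀}`:
`U_{2,m} = U_{2,m₀} + (m − m₀)·T₁₂ + (c_m − c_{m₀})·δ₂₂`, and `T₁₂` (`coloop` after `shift11`) and `δ₂₂` (`shift11` twice)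
preserve (PLD). -/
theorem lift_instance (s : Finset ι) (x f : ι → ℕ)
    (hPLD : ∀ lo hi δ Θ : ℕ, Θ ≤ lo + hi + δ → (lo = 0 ∨ lo + hi + δ ≤ Θ) →
      ∑ i ∈ s, (if lo ≤ x i ∧ x i ≤ hi ∧ Θ ≤ f i + x i then (f i).choose δ else 0) ≤
        ∑ i ∈ s, (if lo + δ ≤ f i ∧ f i ≤ hi + δ then (f i).choose δ else 0))
    (m₀ m : ℕ) (hm₀ : 3 ≤ m₀) (hm : m₀ ≤ m) (lo hi δ Θ : ℕ) (hΘ : Θ ≤ lo + hi + δ)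
    (hlo : lo = 0 ∨ lo + hi + δ ≤ Θ)
    (h₀ : ∑ i ∈ s, ∑ j ∈ range (m₀ + 1), Nat.choose m₀ j *
        (if lo ≤ x i + min j 2 ∧ x i + min j 2 ≤ hi ∧ Θ ≤ (f i + min (m₀ - j) 2) + (x i + min j 2) then
          (f i + min (m₀ - j) 2).choose δ else 0) ≤
      ∑ i ∈ s, ∑ j ∈ range (m₀ + 1), Nat.choose m₀ j *
        (if lo + δ ≤ f i + min (m₀ - j) 2 ∧ f i + min (m₀ - j) 2 ≤ hi + δ then (f i + min (m₀ - j) 2).choose δ else 0)) :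
    ∑ i ∈ s, ∑ j ∈ range (m + 1), Nat.choose m j *
        (if lo ≤ x i + min j 2 ∧ x i + min j 2 ≤ hi ∧ Θ ≤ (f i + min (m - j) 2) + (x i + min j 2) then
          (f i + min (m - j) 2).choose δ else 0) ≤
      ∑ i ∈ s, ∑ j ∈ range (m + 1), Nat.choose m j *
        (if lo + δ ≤ f i + min (m - j) 2 ∧ f i + min (m - j) 2 ≤ hi + δ then (f i + min (m - j) 2).choose δ else 0) := by
  -- the two preservers
  have h11 : ∀ lo hi δ Θ : ℕ, Θ ≤ lo + hi + δ → (lo = 0 ∨ lo + hi + δ ≤ Θ) →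
      ∑ i ∈ s, (if lo ≤ x i + 1 ∧ x i + 1 ≤ hi ∧ Θ ≤ (f i + 1) + (x i + 1) then (f i + 1).choose δ else 0) ≤
        ∑ i ∈ s, (if lo + δ ≤ f i + 1 ∧ f i + 1 ≤ hi + δ then (f i + 1).choose δ else 0) :=
    fun lo hi δ Θ h1 h2 => PLDClosure.shift11 s x f hPLD lo hi δ Θ h1 h2
  have hT := PLDClosure.coloop s (fun i => x i + 1) (fun i => f i + 1) h11 lo hi δ Θ hΘ hlo
  have hS := PLDClosure.shift11 s (fun i => x i + 1) (fun i => f i + 1) h11 lo hi δ Θ hΘ hlo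
  beta_reduce at hT hS
  -- the five layers, for `m` and for `m₀`
  have hLm : ∀ n : ℕ, 3 ≤ n → ∀ i ∈ s, ∑ j ∈ range (n + 1), Nat.choose n j *
        (if lo ≤ x i + min j 2 ∧ x i + min j 2 ≤ hi ∧ Θ ≤ (f i + min (n - j) 2) + (x i + min j 2) then
          (f i + min (n - j) 2).choose δ else 0) =
      (if lo ≤ x i + 0 ∧ x i + 0 ≤ hi ∧ Θ ≤ (f i + 2) + (x i + 0) then (f i + 2).choose δ else 0) +
        n * (if lo ≤ x i + 1 ∧ x i + 1 ≤ hi ∧ Θ ≤ (f i + 2) + (x i + 1) then (f i + 2).choose δ else 0) +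
        (∑ i ∈ Ico 2 (n - 1), n.choose i) *
          (if lo ≤ x i + 2 ∧ x i + 2 ≤ hi ∧ Θ ≤ (f i + 2) + (x i + 2) then (f i + 2).choose δ else 0) +
        n * (if lo ≤ x i + 2 ∧ x i + 2 ≤ hi ∧ Θ ≤ (f i + 1) + (x i + 2) then (f i + 1).choose δ else 0) +
        (if lo ≤ x i + 2 ∧ x i + 2 ≤ hi ∧ Θ ≤ (f i + 0) + (x i + 2) then (f i + 0).choose δ else 0) :=
    fun n hn i _ => sum_choose_min_two n hn
      (fun a b => if lo ≤ x i + a ∧ x i + a ≤ hi ∧ Θ ≤ (f i + b) + (x i + a) then (f i + b).choose δ else 0)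
  have hRm : ∀ n : ℕ, 3 ≤ n → ∀ i ∈ s, ∑ j ∈ range (n + 1), Nat.choose n j *
        (if lo + δ ≤ f i + min (n - j) 2 ∧ f i + min (n - j) 2 ≤ hi + δ then (f i + min (n - j) 2).choose δ else 0) =
      (if lo + δ ≤ f i + 2 ∧ f i + 2 ≤ hi + δ then (f i + 2).choose δ else 0) +
        n * (if lo + δ ≤ f i + 2 ∧ f i + 2 ≤ hi + δ then (f i + 2).choose δ else 0) +
        (∑ i ∈ Ico 2 (n - 1), n.choose i) * (if lo + δ ≤ f i + 2 ∧ f i + 2 ≤ hi + δ then (f i + 2).choose δ else 0) +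
        n * (if lo + δ ≤ f i + 1 ∧ f i + 1 ≤ hi + δ then (f i + 1).choose δ else 0) +
        (if lo + δ ≤ f i + 0 ∧ f i + 0 ≤ hi + δ then (f i + 0).choose δ else 0) :=
    fun n hn i _ => sum_choose_min_two n hn
      (fun _ b => if lo + δ ≤ f i + b ∧ f i + b ≤ hi + δ then (f i + b).choose δ else 0)
  rw [sum_congr rfl (hLm m (hm₀.trans hm)), sum_congr rfl (hRm m (hm₀.trans hm))]
  rw [sum_congr rfl (hLm m₀ hm₀), sum_congr rfl (hRm m₀ hm₀)] at h₀
  simp only [sum_add_distrib, ← mul_sum] at h₀ ⊢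
  rw [sum_add_distrib, sum_add_distrib] at hT
  obtain ⟨k, hk⟩ := Nat.exists_eq_add_of_le hm
  obtain ⟨k', hk'⟩ := Nat.exists_eq_add_of_le (sum_choose_mid_mono m₀ m hm)
  rw [hk', hk]
  simp only [add_zero, show ∀ n : ℕ, n + 1 + 1 = n + 2 from fun _ => rfl] at hT hS h₀ ⊢
  have hTk := Nat.mul_le_mul_left k hT
  have hSk := Nat.mul_le_mul_left k' hS
  nlinarith [hTk, hSk, h₀]

end PLDTwoLiftGen

end PercRepro
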